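import Summits.QuantumFields.YangMills.Theorems.UnitScaleTiltProp7SymAvgTwDefs
import Summits.QuantumFields.YangMills.Theorems.UnitScaleTiltProp7SymAvgGLSmallOfRegPr
import Summits.QuantumFields.YangMills.Theorems.UnitScaleTiltProp7SymAvgGLBridge
import Summits.QuantumFields.YangMills.Theorems.UnitScaleTiltProp7PrintLettersSanity
import Summits.QuantumFields.YangMills.Theorems.UnitScaleTiltProp7TPrintDefs
import HarnessLib

/-!
# `UnitScaleTiltProp7SymAvgTwFrameAxial` — ON PRINT'S AXIAL SURFACE THE TWISTED AND THE UNTWISTED CHARTS COINCIDE: if `e^{A}U₀` lies in the axial gauge (1.19) relative to `U₀`, then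
# [Balaban1985Averaging] (87) «u(y) = (\overline{R_{0,y}U₁}^{(k)})⁻¹» for the (1.29)-restricted transformation `u ≡ 1` gives `\overline{R_{0,·}e^{A}}^{(k)} ≡ 1`, i.e. **`frameTw U₀ A ≡ 1`**,
# hence `dbarTw U₀ A = D̄_GL(e^{A}U₀)·D̄_GL(U₀)⁻¹` and **`logChartTw U₀ A = logChartSym U₀ A`**; in particular `frameTw U₀ 0 ≡ 1`, `dbarTw U₀ 0 ≡ 1`, `logChartTw U₀ 0 = 0`
# (route `UnitScaleTilt`, crux K1 «MinimiserStabilityRegPr» stmt-QuantumFields-19200, stub `stub_existenceMinimalOrbit` (EX), route (α), (AVG-SYM); OWNER RULING g26-№1 Σ-TWIST (T), towards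
# items (3c)–(3e): the identity behind `QTw(D_{U₀}ȟη) = QSym(D_{U₀}ȟη)` for covariantly-constant gauge directions and the bridge `H^{tw}`; def-free, count-neutral)

Cell `ym3-torus` (HUMAN RULING D-0037, YM ladder rung R3 — YM₃ on T³ is a rung, not d = 4, not a mass gap, not Clay), width seat `ym-ust-20520-w5` (gen 3).

THE PRINT.  [Balaban1985Averaging] p. 31 (87): «u(y) = (\overline{R_{0,y}U₁}^{(k)})⁻¹ on Ω^{(k)}», (88): «\overline{(U₁U₀)^u}^k = … », (89)–(92) (the double-bar average); p. 30 (78)–(81)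
(the averages `R̄₀uʲ`; `R̄₀1 = 1`).  [Balaban1985RegularSpaces] p. 78: «the surfaces pass through the element U₀», (1.19) p. 79, (1.29) p. 81.  [Balaban1985Variational] (18) p. 280 («U ∈
Ax_k(𝔅_k, U₀)»), (44) p. 285.

WHAT IS PROVED (sorry-free, no definition):
* §1 on `ℤᵈ` (any complete normed `ℂ`-algebra): `mgauge_const_one` ((55) at `v ≡ 1`), `restr129_const_one` ((1.29) for `u ≡ 1`, `B7Eq78Linearization.Rbar_one`),
  ★**`wrec_eq_one_of_inAx`** — `InAx L k Λ U₀ (U₁U₀) ⟹ wrec L U₀ U₁ j y = 1` on `Λ_j`, `j ≤ k` (`B8Eq131Derivation.eq87_of_inAx_restr129` at `u ≡ 1`).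
* §2 at the T³ objects (GL-valued exponent `A`): `pull_expUnit_mul_bgUnits`, ★**`frameTw_eq_one_of_inAx`**, **`dbarTw_eq_of_inAx`**, ★★**`logChartTw_eq_logChartSym_of_inAx`** — the chart of
  record (p605671) and the (AVG-SYM) core agree on the axial slice; `inAx_zero` (`e^{0}U₀ = U₀` is axial, `Prop7PrintLettersSanity.inAx_based_self`), **`frameTw_zero`**, **`dbarTw_zero`**,
  **`logChartTw_zero`**.
* §3 print's `SU(2)` reading: `inAx_of_isAxialPrint` (`IsAxialPrint F n K U₀ (e^{iX}U₀)` IS the GL hypothesis at `A = iX`), ★`logChartTw_eq_logChartSym_of_isAxialPrint`.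
HONEST FRAMING.  Exact identities over landed letters (no estimate, no window); nothing of print is asserted.  `--supports stmt-QuantumFields-19200 --as helper`.

References: T. Bałaban, CMP 98 (1985) 17–51 [Balaban1985Averaging] ((55) p.27, (78)–(82) p.30, (87)–(92) p.31, (97) p.32); CMP 99 (1985) 75–102 [Balaban1985RegularSpaces] (p.78, (1.19)
p.79, (1.29) p.81); CMP 102 (1985) 277–309 [Balaban1985Variational] ((15) p.280, (18)–(19) pp.280–281, (44) p.285); CMP 99 (1985) 389–434 [Balaban1985BackgroundPropagators] ((3.14) p.393).
-/

set_option autoImplicit false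

noncomputable section

open scoped Matrix.Norms.L2Operator

namespace Summit.QuantumFields.YangMills.Theorems.Prop7SymAvgTwFrameAxial

open NormedSpace
open Literature.MathematicalPhysics.QuantumFieldTheory.Balaban1983to89
open Literature.MathematicalPhysics.QuantumFieldTheory.Balaban1983to89.T3ContinuumYM3Torus
open T3LevelShift (siteShift)
open T3PrintedRegularOrbits (sites_eq)
open T3SectALandauChart (bgUnits emb15)
open B7Prop1Explicit renaming Site → LSite
open B7Prop1Explicit (expUnit val_expUnit)
open B7Eq92Concrete (mgauge Rc Rc_apply)
open B7Eq99Concrete (wrec)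
open B7AvgGaugeCovariance (uLev)
open B7Eq78Linearization (Rbar_one)
open B8Eq119TwistedAxial (InAx Restr129)
open B8Eq131Derivation (eq87_of_inAx_restr129)
open B8Thm4TorusAt (torusLam mem_torusLam_iff)
open B10Eq27TorusAxialLog (pull pull_apply unitsField toUField val_unitsField)
open MatrixLog (mlog)
open Summit.QuantumFields.YangMills.Theorems.Prop7SPrint (basePt IsAxialPrint)
open Summit.QuantumFields.YangMills.Theorems.Prop7TPrint (expHermField expHermField_apply coe_expHerm)
open Summit.QuantumFields.YangMills.Theorems.Prop7SymAvgGL (descendToGL logChartSym)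
open Summit.QuantumFields.YangMills.Theorems.Prop7SymAvgGLSmallOfRegPr (bgUnits_eq)
open Summit.QuantumFields.YangMills.Theorems.Prop7SymAvgTw (coordT3 frameTw dbarTw logChartTw)
open Summit.QuantumFields.YangMills.Theorems.Prop7ChartSigmaT3 (pull_emb15)

variable {d : ℕ} {𝔸 : Type*} [NormedRing 𝔸] [NormedAlgebra ℂ 𝔸] [CompleteSpace 𝔸]

/-! ## §1 On `ℤᵈ`: the accumulated frame of an AXIAL perturbation is `1` ((87) with `u = 1`) -/

omit [NormedAlgebra ℂ 𝔸] [CompleteSpace 𝔸] in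
/-- The moving-frame gauge action (55) of the trivial transformation is trivial: `mgauge V₀ 1 V₁ = V₁`. [cite: Balaban1985Averaging, (55) p.27] -/
theorem mgauge_const_one (V₀ V₁ : LSite d → Fin d → 𝔸ˣ) : mgauge V₀ (fun _ => (1 : 𝔸ˣ)) V₁ = V₁ := by
  funext x κ
  simp only [B7Eq92Concrete.mgauge_apply, one_mul, map_one, inv_one, mul_one]

/-- (1.29) holds for `u ≡ 1` relative to every background (`R̄₀1ʲ = 1`, `B7Eq78Linearization.Rbar_one`). [cite: Balaban1985RegularSpaces, (1.29) p.81; Balaban1985Averaging, (78)–(81) p.30] -/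
theorem restr129_const_one (L k : ℕ) (Λ : ℕ → Set (LSite d)) (U₀ : LSite d → Fin d → 𝔸ˣ) :
    Restr129 L k Λ U₀ (fun _ => (1 : 𝔸ˣ)) := by
  intro j _ y _
  have h1 : (fun x : LSite d => (((fun _ => (1 : 𝔸ˣ)) x : 𝔸ˣ) : 𝔸)) = fun _ => 1 := by funext x; rfl
  rw [h1, Rbar_one]

/-- ★ **THE ACCUMULATED FRAME OF AN AXIAL PERTURBATION IS `1`**: if `U₁U₀` lies ITSELF in the axial gauge (1.19) relative to `U₀` (`InAx L k Λ U₀ (U₁U₀)`), then [Balaban1985Averaging]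
(87) «u(y) = (\overline{R_{0,y}U₁}^{(k)})⁻¹» applied to the (1.29)-restricted transformation `u ≡ 1` gives `\overline{R_{0,y}U₁}^{(j)} = 1` on `Λ_j`, `j ≤ k`
(`B8Eq131Derivation.eq87_of_inAx_restr129`). [cite: Balaban1985Averaging, (87) p.31, (82) p.30, (97) p.32; Balaban1985RegularSpaces, (1.19) p.79, (1.29) p.81] -/
theorem wrec_eq_one_of_inAx (L : ℕ) (hL : 1 ≤ L) (k : ℕ) (Λ : ℕ → Set (LSite d)) (U₀ U₁ : LSite d → Fin d → 𝔸ˣ)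
    (hAx : InAx L k Λ U₀ (U₁ * U₀)) : ∀ j, j ≤ k → ∀ y ∈ Λ j, wrec L U₀ U₁ j y = 1 := by
  intro j hj y hy
  have hAx' : InAx L k Λ U₀ (mgauge U₀ (fun _ => (1 : 𝔸ˣ)) U₁ * U₀) := by rw [mgauge_const_one]; exact hAx
  have h87 := eq87_of_inAx_restr129 L hL k Λ U₀ U₁ (fun _ => (1 : 𝔸ˣ)) hAx' (restr129_const_one L k Λ U₀) j hj y hy
  rw [B7AvgGaugeCovariance.uLev_apply] at h87
  exact inv_eq_one.1 h87.symm

/-! ## §2 At the T³ objects: on the axial slice the twisted chart IS the untwisted chart -/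

variable (F : T3Family) {n K : ℕ} (h : n ≤ K)

/-- The based pullback of the chart configuration `e^{A}·U₀♭` is the product of the pullbacks (bondwise). [cite: Balaban1985Variational, (15) p.280] -/
theorem pull_expUnit_mul_bgUnits (U₀ : GaugeField (F.P K) 0 (Matrix.specialUnitaryGroup (Fin 2) ℂ)) (A : PBond (F.P K) 0 → Matrix (Fin 2) (Fin 2) ℂ)
    (x₀ : Site (F.P K) 0) :
    pull (fun b => expUnit (A b) * bgUnits F K U₀ b) x₀ = pull (fun b => expUnit (A b)) x₀ * pull (bgUnits F K U₀) x₀ := by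
  funext z μ; rfl

/-- ★ **`frameTw U₀ A ≡ 1` WHEN `e^{A}U₀` IS AXIAL RELATIVE TO `U₀`** (based (1.19) on the pullbacks at `x₀ = basePt F n K`, GL-valued `A`): §1 at the T³ objects.
[cite: Balaban1985Averaging, (87) p.31; Balaban1985RegularSpaces, (1.19) p.79] -/
theorem frameTw_eq_one_of_inAx (U₀ : GaugeField (F.P K) 0 (Matrix.specialUnitaryGroup (Fin 2) ℂ)) (A : PBond (F.P K) 0 → Matrix (Fin 2) (Fin 2) ℂ)
    (hAx : InAx (F.P K).L (K - n) (torusLam (K - n)) (pull (bgUnits F K U₀) (basePt F n K))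
      (pull (fun b => expUnit (A b) * bgUnits F K U₀ b) (basePt F n K))) (y : Site (F.P n) 0) :
    frameTw F n K h U₀ A y = 1 := by
  have hL : 1 ≤ (F.P K).L := (F.P K).hL.2.le
  rw [pull_expUnit_mul_bgUnits] at hAx
  exact wrec_eq_one_of_inAx (F.P K).L hL (K - n) (torusLam (K - n)) _ _ hAx (K - n) le_rfl (coordT3 F n K h y)
    ((mem_torusLam_iff (K - n) (K - n) _).2 rfl)

/-- ★ **ON THE AXIAL SLICE THE DOUBLE-BAR AVERAGE IS UNTWISTED**: `e^{A}U₀` axial relative to `U₀` ⟹ `U̿^{tw}(A)(c) = D̄_GL(e^{A}U₀)(c)·D̄_GL(U₀)(c)⁻¹`.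
[cite: Balaban1985Averaging, (88)–(92) p.31; Balaban1985RegularSpaces, (1.19) p.79] -/
theorem dbarTw_eq_of_inAx (U₀ : GaugeField (F.P K) 0 (Matrix.specialUnitaryGroup (Fin 2) ℂ)) (A : PBond (F.P K) 0 → Matrix (Fin 2) (Fin 2) ℂ)
    (hAx : InAx (F.P K).L (K - n) (torusLam (K - n)) (pull (bgUnits F K U₀) (basePt F n K))
      (pull (fun b => expUnit (A b) * bgUnits F K U₀ b) (basePt F n K))) (c : PBond (F.P n) 0) :
    dbarTw F n K h U₀ A c = descendToGL F n K h (fun b => expUnit (A b) * bgUnits F K U₀ b) c * (descendToGL F n K h (bgUnits F K U₀) c)⁻¹ := by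
  rw [Prop7SymAvgTw.dbarTw_def, frameTw_eq_one_of_inAx F h U₀ A hAx, frameTw_eq_one_of_inAx F h U₀ A hAx, inv_one, one_mul, mul_one]

/-- ★★ **ON THE AXIAL SLICE THE TWISTED LOG-CHART IS THE UNTWISTED ONE**: `e^{A}U₀` axial relative to `U₀` ⟹ `logChartTw U₀ A = logChartSym U₀ A` — the two charts of the cell
((AVG-SYM) core and the chart of record) COINCIDE on print's axial surface (18)∕(1.19) through `U₀`; this is the identity behind `QTw(D_{U₀}ȟη) = QSym(D_{U₀}ȟη)` for
covariantly-constant gauge directions (the bridge `H^{tw}` of RULING g26-№1 (2)). [cite: Balaban1985Averaging, (87)–(92) p.31; Balaban1985RegularSpaces, (1.19) p.79; Balaban1985Variational, (18) p.280, (44) p.285] -/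
theorem logChartTw_eq_logChartSym_of_inAx (U₀ : GaugeField (F.P K) 0 (Matrix.specialUnitaryGroup (Fin 2) ℂ)) (A : PBond (F.P K) 0 → Matrix (Fin 2) (Fin 2) ℂ)
    (hAx : InAx (F.P K).L (K - n) (torusLam (K - n)) (pull (bgUnits F K U₀) (basePt F n K))
      (pull (fun b => expUnit (A b) * bgUnits F K U₀ b) (basePt F n K))) :
    logChartTw F n K h U₀ A = logChartSym F n K h U₀ A := by
  funext c
  rw [Prop7SymAvgTw.logChartTw_apply, dbarTw_eq_of_inAx F h U₀ A hAx c]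
  rfl

/-- `e^{0}·U₀♭ = U₀♭` is axial relative to `U₀` (p. 78 «the surfaces pass through the element U₀»; `Prop7PrintLettersSanity.inAx_based_self`), hence **`frameTw U₀ 0 ≡ 1`**,
`dbarTw U₀ 0 ≡ 1` and `logChartTw U₀ 0 = 0`. [cite: Balaban1985RegularSpaces, p.78, (1.19) p.79] -/
theorem inAx_zero (U₀ : GaugeField (F.P K) 0 (Matrix.specialUnitaryGroup (Fin 2) ℂ)) :
    InAx (F.P K).L (K - n) (torusLam (K - n)) (pull (bgUnits F K U₀) (basePt F n K))
      (pull (fun b => expUnit ((0 : PBond (F.P K) 0 → Matrix (Fin 2) (Fin 2) ℂ) b) * bgUnits F K U₀ b) (basePt F n K)) := by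
  have h0 : (fun b => expUnit ((0 : PBond (F.P K) 0 → Matrix (Fin 2) (Fin 2) ℂ) b) * bgUnits F K U₀ b) = bgUnits F K U₀ :=
    Summit.QuantumFields.YangMills.Theorems.Prop7SymAvgGL.expUnit_zero_mul_bgUnits F K U₀
  rw [h0, bgUnits_eq]
  exact Summit.QuantumFields.YangMills.Theorems.Prop7PrintLettersSanity.inAx_based_self (K - n) _ U₀ _

/-- `frameTw U₀ 0 y = 1`. [cite: Balaban1985Averaging, (82) p.30, (97) p.32] -/
theorem frameTw_zero (U₀ : GaugeField (F.P K) 0 (Matrix.specialUnitaryGroup (Fin 2) ℂ)) (y : Site (F.P n) 0) :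
    frameTw F n K h U₀ 0 y = 1 :=
  frameTw_eq_one_of_inAx F h U₀ 0 (inAx_zero F U₀) y

/-- `dbarTw U₀ 0 c = 1`. [cite: Balaban1985Averaging, (89) p.31] -/
theorem dbarTw_zero (U₀ : GaugeField (F.P K) 0 (Matrix.specialUnitaryGroup (Fin 2) ℂ)) (c : PBond (F.P n) 0) :
    dbarTw F n K h U₀ 0 c = 1 := by
  rw [dbarTw_eq_of_inAx F h U₀ 0 (inAx_zero F U₀) c, Summit.QuantumFields.YangMills.Theorems.Prop7SymAvgGL.expUnit_zero_mul_bgUnits, mul_inv_cancel]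

/-- `logChartTw U₀ 0 = 0`. [cite: Balaban1985BackgroundPropagators, (3.14) p.393] -/
theorem logChartTw_zero (U₀ : GaugeField (F.P K) 0 (Matrix.specialUnitaryGroup (Fin 2) ℂ)) : logChartTw F n K h U₀ 0 = 0 := by
  rw [logChartTw_eq_logChartSym_of_inAx F h U₀ 0 (inAx_zero F U₀)]
  exact Summit.QuantumFields.YangMills.Theorems.Prop7SymAvgGL.logChartSym_zero F n K h U₀

/-! ## §3 The `SU(2)` reading: print's `IsAxialPrint` -/

/-- For `X` bondwise Hermitian traceless, the chart configuration `e^{iX}·U₀♭` pulled back IS the pullback of `(e^{iX}U₀)♭` (`emb15`), so print's `IsAxialPrint F n K U₀ (e^{iX}U₀)` is the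
GL-level axial hypothesis of §2 at `A = iX`. [cite: Balaban1985Variational, (15) p.280, (18)–(19) pp.280–281] -/
theorem inAx_of_isAxialPrint (U₀ : GaugeField (F.P K) 0 (Matrix.specialUnitaryGroup (Fin 2) ℂ)) (X : PBond (F.P K) 0 → Matrix (Fin 2) (Fin 2) ℂ)
    (hX : ∀ b : PBond (F.P K) 0, (X b).IsHermitian ∧ Matrix.trace (X b) = 0) (hA : IsAxialPrint F n K U₀ (emb15 U₀ (expHermField X))) :
    InAx (F.P K).L (K - n) (torusLam (K - n)) (pull (bgUnits F K U₀) (basePt F n K))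
      (pull (fun b => expUnit (Complex.I • X b) * bgUnits F K U₀ b) (basePt F n K)) := by
  have hexp : unitsField (toUField (expHermField (F := F) X)) = fun b => expUnit (Complex.I • X b) := by
    funext b
    apply Units.ext
    rw [val_unitsField, val_expUnit, ← coe_expHerm (hX b), ← expHermField_apply]
    rfl
  have hA' : InAx (F.P K).L (K - n) (torusLam (K - n)) (pull (unitsField (toUField U₀)) (basePt F n K))
      (pull (unitsField (toUField (emb15 U₀ (expHermField X)))) (basePt F n K)) := hA
  rw [pull_emb15, hexp] at hA'
  rw [pull_expUnit_mul_bgUnits, bgUnits_eq]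
  exact hA'

/-- ★ **PRINT'S READING**: `(e^{iX}U₀) ∈ Ax_k(𝔅_k, U₀)` (`IsAxialPrint`) ⟹ `frameTw U₀ (iX) ≡ 1` and `logChartTw U₀ (iX) = logChartSym U₀ (iX)`.
[cite: Balaban1985Averaging, (87) p.31; Balaban1985RegularSpaces, (1.19) p.79; Balaban1985Variational, (18) p.280] -/
theorem logChartTw_eq_logChartSym_of_isAxialPrint (U₀ : GaugeField (F.P K) 0 (Matrix.specialUnitaryGroup (Fin 2) ℂ))
    (X : PBond (F.P K) 0 → Matrix (Fin 2) (Fin 2) ℂ) (hX : ∀ b : PBond (F.P K) 0, (X b).IsHermitian ∧ Matrix.trace (X b) = 0)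
    (hA : IsAxialPrint F n K U₀ (emb15 U₀ (expHermField X))) :
    (∀ y, frameTw F n K h U₀ (fun b => Complex.I • X b) y = 1) ∧
      logChartTw F n K h U₀ (fun b => Complex.I • X b) = logChartSym F n K h U₀ (fun b => Complex.I • X b) :=
  ⟨fun y => frameTw_eq_one_of_inAx F h U₀ _ (inAx_of_isAxialPrint F U₀ X hX hA) y,
    logChartTw_eq_logChartSym_of_inAx F h U₀ _ (inAx_of_isAxialPrint F U₀ X hX hA)⟩

end Summit.QuantumFields.YangMills.Theorems.Prop7SymAvgTwFrameAxial

end
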